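import Summits.HodgeConjecture.HodgeConjecture.Theorems.Ring2WeilCoverageWeilGramLevel45XiGram
import Summits.HodgeConjecture.HodgeConjecture.Theorems.Ring2WeilCoverageWeilGramLevel45XiSqrtNegFifteenGram
import Summits.HodgeConjecture.HodgeConjecture.Theorems.Ring2WeilCoverageWeilGramSign
import Summits.HodgeConjecture.HodgeConjecture.Theorems.Ring2WeilCoverageCyclotomicUnconditionalSqrtFive
import HarnessLib

/-!
# Weil-type family coverage — THE COMPONENTS OF THE WEIL-TYPE `ℤ[ζ₄₅]`-TWELVEFOLDS, IV: `θ^i` (`i < 12`) is a `ℚ`-basis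
# of `ℚ(ζ₄₅)⁺`; EVERY principal-type `E_ζ′` has Gram determinant `-2985984` against `s₃` and `-46656000000`
# against `s₁₅` — both NEGATIVE: NO principal-type `E_ζ′` is `Φ`-positive on a `ℚ(√−3)`- or `ℚ(√−15)`-Weil-type
# CM type — the census NO rows `(45, ℚ(√−3))`, `(45, ℚ(√−15))` from van Geemen's SIGN

research route conditional on HC_CM; not a corollary; Q11.4-sentence-2 already refuted in dim ≥ 3.

Ring 2, WEIL-TYPE FAMILY-COVERAGE CENSUS (`HOME/WEIL-FAMILY-COVERAGE.md` `## b01`, blocks b01.38 (the NO rows at `45`),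
b01.41 (C), b01.48 NEXT), part 147 of the `Ring2WeilCoverage*` series; continues parts 145a/b, 146a/b
(`Ring2WeilCoverageWeilGramLevel45Xi[Gram]`, `…XiSqrtNegFifteen[Gram]`: traces, Hankel matrices, determinants).

* §2 `[ℚ(ζ₄₅)⁺ : ℚ] = 12` and **`1, θ, …, θ¹¹` is a `ℚ`-basis of `ℚ(ζ₄₅)⁺`** (a relation is in the kernel of the
  Gram matrix of part 145b, whose determinant is non-zero).
* §3/§4 **EVERY skew `ζ′` of principal type on `ℤ[ζ₄₅]` gives `det a = -2985984`** against `s₃` and **`-46656000000`**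
  against `s₁₅` (part 82 `det_realPart_eq_of_isOfType` + THEOREM L (i) at `45`, `norm_realUnits_pos_fortyFive`, b01.38); **NO such
  `ζ′` is `Φ`-positive on a CM type of `s`-signature `(6,6)`**: `(−1)⁶ det a < 0` against part 92
  `not_pos_of_neg_one_pow_mul_det_nonpos` — the census verdicts at `(45, ℚ(√−3))` and `(45, ℚ(√−15))` (b01.38:
  unit signatures) by a second, independent kernel route (van Geemen's sign of `det H`).

HONEST FRAMING as parts 144/145; `HC_CM` is used nowhere.  No `def`, no named fact, no `sorry`.

References: [cite: vanGeemen1994HodgeAV, Lemma 5.2 (2)–(4), 5.4 and (5.4.1)]; [cite: Shimura1998, §14.3 Prop. 4–5,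
pp. 103–104]; census b01.38, b01.41 (C) (seat-derived).
-/

noncomputable section

open Polynomial NumberField Module
open scoped nonZeroDivisors

namespace Summit.HodgeConjecture.Ring2WeilCoverage.WeilGramLevel45Principal

open Literature.AlgebraicGeometry.VanGeemen1994 (weilField weilNormResidueGroup)
open Literature.AlgebraicGeometry.Motives (CMType normUnitsSubgroup)
open Literature.NumberTheory.ComplexMultiplication
open Summit.HodgeConjecture.Ring2WeilCoverage.WeilGramTools
open Summit.HodgeConjecture.Ring2WeilCoverage.WeilGramCMPoint
open Summit.HodgeConjecture.Ring2WeilCoverage.RealUnitNormHalfSystems (complexConj_eq_inv)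
open Summit.HodgeConjecture.Ring2WeilCoverage.CyclotomicPrincipalObstruction (complexConj_xi)
open Summit.HodgeConjecture.Ring2WeilCoverage.CyclotomicDifferent (isOfType_one_xi_top xi_ne_zero)
open Summit.HodgeConjecture.HodgeConjecture.Ring2.WeilCoverage (mk_neg_eq_split_of_odd mk_neg_ne_split_of_odd
  mk_eq_split_of_even mk_ne_split_of_even mem_normUnitsSubgroup_of_sq_add_mul_sq natCast_not_mem_normUnitsSubgroup_of_ramified)
open Summit.HodgeConjecture.HodgeConjecture.Ring2.Hypotheses (splitDiscriminantClass)
open Summit.HodgeConjecture.Ring2WeilCoverage.WeilGramLevel45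
open Summit.HodgeConjecture.Ring2WeilCoverage.WeilGramLevel45XiGram
open Summit.HodgeConjecture.Ring2WeilCoverage.WeilGramLevel45XiSqrtNegFifteenGram
open Summit.HodgeConjecture.Ring2WeilCoverage.WeilGramSign (not_pos_of_neg_one_pow_mul_det_nonpos)
open Summit.HodgeConjecture.Ring2WeilCoverage.CyclotomicUnconditionalSqrtFive (norm_realUnits_pos_fortyFive)
variable {K : Type} [Field K] [NumberField K] {ζ : K}

/-! ### §2 `1, θ, …, θ¹¹` is a `ℚ`-basis of `K⁺ = ℚ(ζ₄₅)⁺` -/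

/-- `[ℚ(ζ_45)⁺ : ℚ] = 12`. [folklore] -/
theorem finrank_realSubfield [IsCyclotomicExtension {45} ℚ K] [IsCMField K] :
    finrank ℚ (maximalRealSubfield K) = 12 := by
  have h1 : finrank ℚ K = 24 := by
    rw [IsCyclotomicExtension.finrank K (cyclotomic.irreducible_rat (by norm_num : 0 < 45))]; decide
  have h2 := Module.finrank_mul_finrank ℚ (maximalRealSubfield K) K
  rw [Algebra.IsQuadraticExtension.finrank_eq_two (maximalRealSubfield K) K, h1] at h2
  omega

/-- **`1, θ, …, θ^{12−1}` are `ℚ`-linearly independent in `K⁺`**: a relation `Σ cₖ θ^k = 0`, multiplied by `ζ′ s θ^m` and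
traced, says that `c` is in the kernel of the Gram matrix `a` of §1, whose determinant is non-zero.
research route conditional on HC_CM; not a corollary; Q11.4-sentence-2 already refuted in dim ≥ 3. [folklore] -/
theorem linearIndependent_thetaPow [IsCyclotomicExtension {45} ℚ K] [IsCMField K] (hζ : IsPrimitiveRoot ζ 45)
    {ω : Fin 12 → maximalRealSubfield K} (hω : ∀ i, (ω i : K) = (ζ + ζ⁻¹) ^ (i : ℕ)) : LinearIndependent ℚ ω := by
  rw [Fintype.linearIndependent_iff]
  intro c hc
  have hcK : ∑ i : Fin 12, (c i : K) * (ζ + ζ⁻¹) ^ (i : ℕ) = 0 := by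
    have h := congrArg (fun y : maximalRealSubfield K => (y : K)) hc
    simp only [ZeroMemClass.coe_zero] at h
    rw [← h]
    push_cast
    refine Finset.sum_congr rfl fun i _ => ?_
    rw [Rat.smul_def, hω i]
  have E : ∀ m : ℕ, ∑ i : Fin 12, c i * Algebra.trace ℚ K ((ζ ^ 11 * (aeval ζ (derivative (cyclotomic 45 ℚ)))⁻¹) * (1 + 2 * ζ ^ 15) *
      ((ζ + ζ⁻¹) ^ m * (ζ + ζ⁻¹) ^ (i : ℕ))) = 0 := by
    intro m
    have h := congrArg (fun y => Algebra.trace ℚ K ((ζ ^ 11 * (aeval ζ (derivative (cyclotomic 45 ℚ)))⁻¹) * (1 + 2 * ζ ^ 15) * (ζ + ζ⁻¹) ^ m * y)) hcK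
    simp only [mul_zero, map_zero, Finset.mul_sum, map_sum] at h
    rw [← h]
    refine Finset.sum_congr rfl fun i _ => ?_
    rw [show (ζ ^ 11 * (aeval ζ (derivative (cyclotomic 45 ℚ)))⁻¹) * (1 + 2 * ζ ^ 15) * (ζ + ζ⁻¹) ^ m *
        ((c i : K) * (ζ + ζ⁻¹) ^ (i : ℕ)) = (c i) • ((ζ ^ 11 * (aeval ζ (derivative (cyclotomic 45 ℚ)))⁻¹) * (1 + 2 * ζ ^ 15) *
        ((ζ + ζ⁻¹) ^ m * (ζ + ζ⁻¹) ^ (i : ℕ))) by rw [Rat.smul_def]; ring, map_smul, smul_eq_mul]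
  set x : Fin 12 → K := fun i => (ζ + ζ⁻¹) ^ (i : ℕ) with hxdef
  have hx : ∀ i, x i = (ζ + ζ⁻¹) ^ (i : ℕ) := fun i => rfl
  set a : Matrix (Fin 12) (Fin 12) ℚ := Matrix.of fun i j => Algebra.trace ℚ K ((ζ ^ 11 * (aeval ζ (derivative (cyclotomic 45 ℚ)))⁻¹) * x i *
      IsCMField.complexConj K ((1 + 2 * ζ ^ 15) * x j)) with hadef
  have ha : ∀ i j, a i j = Algebra.trace ℚ K ((ζ ^ 11 * (aeval ζ (derivative (cyclotomic 45 ℚ)))⁻¹) * x i *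
      IsCMField.complexConj K ((1 + 2 * ζ ^ 15) * x j)) := fun i j => rfl
  have hdet : a.det ≠ 0 := by
    rw [det_realPart_xi_sqrtNegThree hζ hx ha]; norm_num
  have ha2 : ∀ i j, a i j = -Algebra.trace ℚ K ((ζ ^ 11 * (aeval ζ (derivative (cyclotomic 45 ℚ)))⁻¹) * (1 + 2 * ζ ^ 15) * (x i * x j)) :=
    fun i j => by
      have h := congrFun (congrFun (ha_eq (complexConj_sqrtNegThree hζ) (complexConj_thetaFrame hζ hx) ha) i) j
      rwa [Matrix.of_apply] at h
  have hmv : a.mulVec (fun i => c i) = 0 := by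
    funext m
    simp only [Matrix.mulVec, dotProduct, Pi.zero_apply, ha2, hx, neg_mul]
    rw [Finset.sum_neg_distrib, neg_eq_zero, ← E m]
    exact Finset.sum_congr rfl fun i _ => mul_comm _ _
  have h0 := Matrix.eq_zero_of_mulVec_eq_zero hdet hmv
  intro i
  simpa using congrFun h0 i

/-- **A `ℚ`-basis `ωb` of `K⁺ = ℚ(ζ_45)⁺` with `ωb i = θ^i`** (`i < 12`). [folklore] -/
theorem exists_basis_thetaPow [IsCyclotomicExtension {45} ℚ K] [IsCMField K] (hζ : IsPrimitiveRoot ζ 45) :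
    ∃ ωb : Basis (Fin 12) ℚ (maximalRealSubfield K), ∀ i, (ωb i : K) = (ζ + ζ⁻¹) ^ (i : ℕ) := by
  let θ' : maximalRealSubfield K :=
    ⟨ζ + ζ⁻¹, (IsCMField.complexConj_eq_self_iff K (ζ + ζ⁻¹)).mp (complexConj_theta hζ)⟩
  let ω : Fin 12 → maximalRealSubfield K := fun i => θ' ^ (i : ℕ)
  have hω : ∀ i, (ω i : K) = (ζ + ζ⁻¹) ^ (i : ℕ) := fun i => by simp [ω, θ']
  have hli := linearIndependent_thetaPow hζ hω
  have hcard : Fintype.card (Fin 12) = finrank ℚ (maximalRealSubfield K) := by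
    rw [Fintype.card_fin, finrank_realSubfield]
  exact ⟨basisOfLinearIndependentOfCardEqFinrank hli hcard, fun i => by
    rw [coe_basisOfLinearIndependentOfCardEqFinrank]; exact hω i⟩

/-! ### §3 Against `s₃`: every principal-type parameter gives `-2985984`; the NO row `(45, ℚ(√−3))` -/

/-- **For EVERY skew `ζ′` of PRINCIPAL type on `ℤ[ζ_45]` (`IsOfType 1 ζ′ ⊤`; `ζ′ = uξ`, `u` a real unit, `N(u) = 1`
by THEOREM L (i) at `45`) the Gram determinant of `(E_ζ′, s₃)` in the frame `θ^i` (`i < 12`) is `-2985984`** (such `ζ′` exist for SOME `Φ`, but — below — for no `ℚ(√−3)`-Weil-type `Φ`): the census NO row `(45, ℚ(√−3))`;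
`(−1)⁶ det a < 0`: the WRONG sign for Weil signature `(6,6)` [vG94 5.2 (4)] — see the NO-row theorem.
research route conditional on HC_CM; not a corollary; Q11.4-sentence-2 already refuted in dim ≥ 3. [cite: vanGeemen1994HodgeAV, Lemma 5.2 (3)–(4) and (5.4.1)] [cite: Shimura1998, §14.3 Prop. 5, p. 104] -/
theorem det_realPart_principal_sqrtNegThree [IsCyclotomicExtension {45} ℚ K] [IsCMField K]
    (hζ : IsPrimitiveRoot ζ 45) {ζ' : K} (hζ' : IsCMField.complexConj K ζ' = -ζ')
    (hT : CMTypeLattice.IsOfType (1 : (FractionalIdeal (𝓞 K)⁰ K)ˣ) ζ' ⊤)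
    {x : Fin 12 → K} (hx : ∀ i, x i = (ζ + ζ⁻¹) ^ (i : ℕ)) {a : Matrix (Fin 12) (Fin 12) ℚ}
    (ha : ∀ i j, a i j = Algebra.trace ℚ K (ζ' * x i * IsCMField.complexConj K ((1 + 2 * ζ ^ 15) * x j))) :
    a.det = -2985984 := by
  obtain ⟨ωb, hωb⟩ := exists_basis_thetaPow hζ
  have hx' : ∀ i, x i = (ωb i : K) := fun i => (hx i).trans (hωb i).symm
  rw [det_realPart_eq_of_isOfType ωb (complexConj_sqrtNegThree hζ) hx' (norm_realUnits_pos_fortyFive hζ)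
    (complexConj_xi_fortyFive hζ) (xi_ne_zero hζ 11) hζ' (isOfType_one_xi_top hζ 11) hT (fun i j => rfl) ha]
  exact det_realPart_xi_sqrtNegThree hζ hx (fun i j => rfl)

open scoped Classical in
/-- **NO principal-type `E_ζ′` on `ℤ[ζ_45]` is `Φ`-positive on a `ℚ(√−3)`-signature-`(6,6)` CM type** (`s = √−3 = 1 + 2ζ¹⁵`):
`det a = -2985984` for every skew principal-type `ζ′` (above), while van Geemen's sign would force `0 < (−1)^6 det a`
(part 92 `not_pos_of_neg_one_pow_mul_det_nonpos`) — the census NO row `(45, ℚ(√−3))` (THEOREM L there via unit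
signatures) RE-DERIVED from a determinant sign.
research route conditional on HC_CM; not a corollary; Q11.4-sentence-2 already refuted in dim ≥ 3. [cite: vanGeemen1994HodgeAV, Lemma 5.2 (4)] [cite: Shimura1998, §14.3 Prop. 4–5, pp. 103–104] -/
theorem not_pos_of_principal_sqrtNegThree [IsCyclotomicExtension {45} ℚ K] [IsCMField K] (hζ : IsPrimitiveRoot ζ 45)
    (Φ : CMType K)
    (hneg : (Finset.univ.filter fun φ : Φ.1 => (φ.1 (1 + 2 * ζ ^ 15)).im < 0).card = 6)
    (hposc : (Finset.univ.filter fun φ : Φ.1 => 0 < (φ.1 (1 + 2 * ζ ^ 15)).im).card = 6)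
    {ζ' : K} (hζ' : IsCMField.complexConj K ζ' = -ζ')
    (hT : CMTypeLattice.IsOfType (1 : (FractionalIdeal (𝓞 K)⁰ K)ˣ) ζ' ⊤) :
    ¬ ∀ φ : Φ.1, 0 < (φ.1 ζ').im := by
  obtain ⟨ωb, hωb⟩ := exists_basis_thetaPow hζ
  have hs := complexConj_sqrtNegThree hζ
  have hs0 : ((1 + 2 * ζ ^ 15) : K) ≠ 0 := fun h => by
    have h2 := sq_sqrtNegThree hζ
    rw [h] at h2
    norm_num at h2
  obtain ⟨γ₀, hγ⟩ := exists_real_eq_mul_of_skew hζ' hs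
  set A : Matrix (Fin 12) (Fin 12) ℚ := Matrix.of fun i j => Algebra.trace ℚ K (ζ' * (ωb i : K) *
      IsCMField.complexConj K ((1 + 2 * ζ ^ 15) * (ωb j : K))) with hA
  have hA' : ∀ i j, A i j = Algebra.trace ℚ K (ζ' * (ωb i : K) *
      IsCMField.complexConj K ((1 + 2 * ζ ^ 15) * (ωb j : K))) := fun i j => rfl
  have hdet := det_realPart_principal_sqrtNegThree hζ hζ' hT (x := fun i => (ωb i : K)) hωb hA'
  have hζ'0 : ζ' ≠ 0 := by
    intro h0
    have hzero : A = 0 := by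
      ext i j
      simp [hA, h0]
    rw [hzero, Matrix.det_zero] at hdet
    norm_num at hdet
  exact not_pos_of_neg_one_pow_mul_det_nonpos Φ ωb hζ' hs hs0 hζ'0 hneg hposc (fun i => rfl) hγ hA'
    (by rw [hdet]; norm_num)

/-! ### §4 Against `s₁₅`: every principal-type parameter gives `-46656000000`; the NO row `(45, ℚ(√−15))` -/

/-- **For EVERY skew `ζ′` of PRINCIPAL type on `ℤ[ζ_45]` (`IsOfType 1 ζ′ ⊤`; `ζ′ = uξ`, `u` a real unit, `N(u) = 1`
by THEOREM L (i) at `45`) the Gram determinant of `(E_ζ′, s₁₅)` in the frame `θ^i` (`i < 12`) is `-46656000000`** (such `ζ′` exist for SOME `Φ`, but — below — for no `ℚ(√−15)`-Weil-type `Φ`): the census NO row `(45, ℚ(√−15))`;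
`(−1)⁶ det a < 0`: the WRONG sign for Weil signature `(6,6)` [vG94 5.2 (4)] — see the NO-row theorem.
research route conditional on HC_CM; not a corollary; Q11.4-sentence-2 already refuted in dim ≥ 3. [cite: vanGeemen1994HodgeAV, Lemma 5.2 (3)–(4) and (5.4.1)] [cite: Shimura1998, §14.3 Prop. 5, p. 104] -/
theorem det_realPart_principal_sqrtNegFifteen [IsCyclotomicExtension {45} ℚ K] [IsCMField K]
    (hζ : IsPrimitiveRoot ζ 45) {ζ' : K} (hζ' : IsCMField.complexConj K ζ' = -ζ')
    (hT : CMTypeLattice.IsOfType (1 : (FractionalIdeal (𝓞 K)⁰ K)ˣ) ζ' ⊤)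
    {x : Fin 12 → K} (hx : ∀ i, x i = (ζ + ζ⁻¹) ^ (i : ℕ)) {a : Matrix (Fin 12) (Fin 12) ℚ}
    (ha : ∀ i j, a i j = Algebra.trace ℚ K (ζ' * x i * IsCMField.complexConj K (((1 + 2 * ζ ^ 15) * (1 + 2 * (ζ ^ 9 + ζ ^ 36))) * x j))) :
    a.det = -46656000000 := by
  obtain ⟨ωb, hωb⟩ := exists_basis_thetaPow hζ
  have hx' : ∀ i, x i = (ωb i : K) := fun i => (hx i).trans (hωb i).symm
  rw [det_realPart_eq_of_isOfType ωb (complexConj_sqrtNegFifteen hζ) hx' (norm_realUnits_pos_fortyFive hζ)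
    (complexConj_xi_fortyFive hζ) (xi_ne_zero hζ 11) hζ' (isOfType_one_xi_top hζ 11) hT (fun i j => rfl) ha]
  exact det_realPart_xi_sqrtNegFifteen hζ hx (fun i j => rfl)

open scoped Classical in
/-- **NO principal-type `E_ζ′` on `ℤ[ζ_45]` is `Φ`-positive on a `ℚ(√−15)`-signature-`(6,6)` CM type** (`s = √−15 = (1 + 2ζ¹⁵)(1 + 2(ζ⁹ + ζ³⁶))`):
`det a = -46656000000` for every skew principal-type `ζ′` (above), while van Geemen's sign would force `0 < (−1)^6 det a`
(part 92 `not_pos_of_neg_one_pow_mul_det_nonpos`) — the census NO row `(45, ℚ(√−15))` (THEOREM L there via unit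
signatures) RE-DERIVED from a determinant sign.
research route conditional on HC_CM; not a corollary; Q11.4-sentence-2 already refuted in dim ≥ 3. [cite: vanGeemen1994HodgeAV, Lemma 5.2 (4)] [cite: Shimura1998, §14.3 Prop. 4–5, pp. 103–104] -/
theorem not_pos_of_principal_sqrtNegFifteen [IsCyclotomicExtension {45} ℚ K] [IsCMField K] (hζ : IsPrimitiveRoot ζ 45)
    (Φ : CMType K)
    (hneg : (Finset.univ.filter fun φ : Φ.1 => (φ.1 ((1 + 2 * ζ ^ 15) * (1 + 2 * (ζ ^ 9 + ζ ^ 36)))).im < 0).card = 6)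
    (hposc : (Finset.univ.filter fun φ : Φ.1 => 0 < (φ.1 ((1 + 2 * ζ ^ 15) * (1 + 2 * (ζ ^ 9 + ζ ^ 36)))).im).card = 6)
    {ζ' : K} (hζ' : IsCMField.complexConj K ζ' = -ζ')
    (hT : CMTypeLattice.IsOfType (1 : (FractionalIdeal (𝓞 K)⁰ K)ˣ) ζ' ⊤) :
    ¬ ∀ φ : Φ.1, 0 < (φ.1 ζ').im := by
  obtain ⟨ωb, hωb⟩ := exists_basis_thetaPow hζ
  have hs := complexConj_sqrtNegFifteen hζ
  have hs0 : (((1 + 2 * ζ ^ 15) * (1 + 2 * (ζ ^ 9 + ζ ^ 36))) : K) ≠ 0 := fun h => by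
    have h2 := sq_sqrtNegFifteen hζ
    rw [h] at h2
    norm_num at h2
  obtain ⟨γ₀, hγ⟩ := exists_real_eq_mul_of_skew hζ' hs
  set A : Matrix (Fin 12) (Fin 12) ℚ := Matrix.of fun i j => Algebra.trace ℚ K (ζ' * (ωb i : K) *
      IsCMField.complexConj K (((1 + 2 * ζ ^ 15) * (1 + 2 * (ζ ^ 9 + ζ ^ 36))) * (ωb j : K))) with hA
  have hA' : ∀ i j, A i j = Algebra.trace ℚ K (ζ' * (ωb i : K) *
      IsCMField.complexConj K (((1 + 2 * ζ ^ 15) * (1 + 2 * (ζ ^ 9 + ζ ^ 36))) * (ωb j : K))) := fun i j => rfl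
  have hdet := det_realPart_principal_sqrtNegFifteen hζ hζ' hT (x := fun i => (ωb i : K)) hωb hA'
  have hζ'0 : ζ' ≠ 0 := by
    intro h0
    have hzero : A = 0 := by
      ext i j
      simp [hA, h0]
    rw [hzero, Matrix.det_zero] at hdet
    norm_num at hdet
  exact not_pos_of_neg_one_pow_mul_det_nonpos Φ ωb hζ' hs hs0 hζ'0 hneg hposc (fun i => rfl) hγ hA'
    (by rw [hdet]; norm_num)

end Summit.HodgeConjecture.Ring2WeilCoverage.WeilGramLevel45Principal

end
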